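import Literature.NumberTheory.GaloisCohomology.FiniteSingularComparison
import HarnessLib

/-!
# Kolyvagin systems RESTRICT to sub-data with thinner Kolyvagin primes (TOOL)
# (cell `b2b-bsdres`, team n1011; planner r1 GEN 48 END-b ruling (C)(a1); seat n1011-p11 GEN 12, row T-KS-RES)

HONEST FRAMING (cell `b2b-bsdres`, run/shared/lean/b2b/bsd-rank1-residual/, verbatim in every
file): the goal of the cell is to DELETE the COMBINATION-SHAPED residual classes of the
Birch–Swinnerton-Dyer formula for ALL analytic-rank `≤ 1` elliptic curves over `ℚ` — "full BSD
formula for every rank `≤ 1` curve in class `C`" assembled STRICTLY from published theorems — so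
that the rank-`≤ 1` remainder becomes exactly the CONSTRUCTION-SHAPED classes, which are TYPED
(missing-input `Prop`s), NOT attempted. This is not "finishing BSD". Team n1011 (N10/N11, the
additive block `X4 ∧ p = 3`): research route on the CONSTRUCTION-SHAPED class X4 / §I N11
(route-1 PORT); a TOOL file about the VOCABULARY of Kolyvagin systems
(`Literature/NumberTheory/GaloisCohomology/KolyvaginSystems.lean`): no class theorem, nothing
booked, no mark / label changed; no definition, no named fact, no `sorry`.

## What (planner r1 GEN 48, cells/n1011/ROUTE-1.md §60.2 (i) / cell INBOX 11:02Z (C)(a1): "Kolyvagin-system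
RESTRICTION to a sub-datum `{D with primes := D.primes ∩ C_B}` is one XS TOOL lemma
(`κ′ d := if ↑d ⊆ 𝒫′ then κ d else 0`; `IsKolyvaginSystem`'s three clauses … restrict verbatim;
not in the tree yet")

Let `K` be a number field, `ρ` a discrete `Γ_K`-module on `M`, `𝓕` a Selmer structure, and
`D`, `D′` two Kolyvagin data (Sakamoto Def. 4.1 / Rubin Def. 2.1.3: the set `𝒫` of Kolyvagin
primes, the transverse conditions, the finite–singular comparison maps) with
`𝒫(D′) ⊆ 𝒫(D)`, the SAME transverse conditions and the same comparison maps at the primes of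
`𝒫(D′)` — in particular the sub-datum `{D with primes := 𝒫′}` for any `𝒫′ ⊆ 𝒫(D)`.  Then:

* `isLevel_of_primes_subset`, `atLevel_eq_of_transverse_eq`, `fsLocalization_eq_of_fs_eq` — the
  levels `𝒩(D′) ⊆ 𝒩(D)`, the vertex structures `𝓕(d)` and the maps `φ^{fs}_𝔮 ∘ loc_𝔮` agree;
* ★ `isKolyvaginSystem_of_primes_subset` — if `κ ∈ KS₁(T, 𝓕, 𝒫(D))` and `κ′` AGREES with `κ` on
  the levels of `D′` and VANISHES off them, then `κ′ ∈ KS₁(T, 𝓕, 𝒫(D′))` (the three clauses of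
  Def. 4.1 — support, `κ_d ∈ H¹_{𝓕(d)}`, the finite–singular relation at `𝔮 ∉ d` — restrict
  verbatim, because every level / prime of `D′` is one of `D`);
* ★ `isKolyvaginSystem_restrict` — the extension-by-zero spelling
  `κ′ d := if 𝒫-level(D′, d) then κ d else 0`, and ★ `isKolyvaginSystem_restrictPrimes` — the same
  for the sub-datum `{D with primes := 𝒫′}` with `κ′ d := if ↑d ⊆ 𝒫′ then κ d else 0` (r1's
  spelling); `restrict_apply_of_isLevel` / `restrict_apply_empty` — the restricted family has the
  SAME classes at the common levels, in particular the same bottom class `κ_1` (the class that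
  carries the `L`-value in the applications); `restrict_eq_self_of_isKolyvaginSystem` — restricting to `𝒫(D)` itself is
  the identity on Kolyvagin systems; `mem_kolyvaginSystems_restrictPrimes` — the `KS₁` form;
* `hasCanonicalComparison_of_primes_subset`, `isAdmissible_of_primes_subset` (+ `…_restrictPrimes`) — THE canonical
  comparison maps for `η` (Kim's generator-fixed convention) and admissibility are inherited by
  sub-data (both are "for every `𝔮 ∈ 𝒫`" clauses).

The E[3^{j+1}]-side With-guard of the PORT′ is inherited by sub-data by the tree's
`KolyvaginDatum.IsCanonicalTauDatumThreeAtWith.of_primes_subset`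
(`GaloisImage/KatoKuriharaPortThreeWith.lean`); this file is its Kolyvagin-SYSTEM companion and is
kept generic (any `K`, any `ρ`), importing only the vocabulary files.  Intended consumer: the
END-b twin of T-PK6-M1-END on the THINNED prime set (r1's option (a): `𝒫′ = 𝒫 ∩ C_B`, the
`τ`-class primes at which every `3`-anomalous bad prime is a cube), together with a thinned
prime-choice TOOL ((a2), not here).

References: R. Sakamoto, *The theory of Kolyvagin systems for p = 3*, JTNB 36 (2024), §2
(p. 921: the levels `𝒩`), Def. 4.1 (p. 926); K. Rubin, *Euler systems and Kolyvagin systems*,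
PCMI 18 (2011), Def. 2.1.3, Def. 2.2.1 (pp. 17–18); C.-H. Kim, AJM 148 (2026) §2.2.2 (the
generator-fixed convention); B. Mazur, K. Rubin, *Kolyvagin systems*, Mem. AMS 799 (2004), Def. 3.1.3
(Kolyvagin systems for a triple `(T, 𝓕, 𝒫)`; the dependence on the set of primes `𝒫` is the point of
this file).  Every statement below is an immediate consequence of the DEFINITIONS (restriction of
universally quantified clauses to a subset); no theorem of the sources is used.
-/

noncomputable section

open Function NumberField IsDedekindDomain Field
open scoped NumberField ContRepresentation Classical
open Literature.NumberTheory.GaloisRepresentations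
open Literature.NumberTheory.GaloisRepresentations.DiscreteGaloisModule

universe u

namespace Summit.BirchSwinnertonDyer.Rank1Residual.GaloisImage.KSRestrict

open Literature.NumberTheory.GaloisCohomology Literature.NumberTheory.GaloisCohomology.KolyvaginDatum

variable {K : Type u} [Field K] [NumberField K]
variable {M : Type u} [AddCommGroup M] [TopologicalSpace M] [DiscreteTopology M]
variable {ρ : DiscreteGaloisModule K M}

/-! ## Levels, vertex structures and comparison maps of a sub-datum -/

/-- A level of the sub-datum is a level of the datum: `𝒩(D′) ⊆ 𝒩(D)` when `𝒫(D′) ⊆ 𝒫(D)`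
(the levels are the finite sets of Kolyvagin primes). [cite: Sakamoto2024, §2 (p. 921)]
[cite: Rubin2011, Def. 2.1.3 (p. 17)] -/
theorem isLevel_of_primes_subset {D D' : KolyvaginDatum ρ} (hPP : D'.primes ⊆ D.primes)
    {d : Finset (HeightOneSpectrum (𝓞 K))} (hd : D'.IsLevel d) : D.IsLevel d :=
  Set.Subset.trans hd hPP

/-- The levels of the sub-datum `{D with primes := 𝒫′}` are the finite subsets of `𝒫′`.
[cite: Sakamoto2024, §2 (p. 921)] -/
theorem isLevel_restrictPrimes_iff (D : KolyvaginDatum ρ) (P' : Set (HeightOneSpectrum (𝓞 K)))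
    (d : Finset (HeightOneSpectrum (𝓞 K))) :
    ({ D with primes := P' } : KolyvaginDatum ρ).IsLevel d ↔ ↑d ⊆ P' :=
  Iff.rfl

/-- The vertex Selmer structures `𝓕(d)` depend only on the transverse conditions: two data with
the same transverse conditions have the same `𝓕(d)` at every `d`.
[cite: Sakamoto2024, Def. 3.3 (p. 922)] [cite: Rubin2011, Def. 2.2.3 (p. 18)] -/
theorem atLevel_eq_of_transverse_eq {D D' : KolyvaginDatum ρ} (hT : D'.transverse = D.transverse)
    (𝓕 : SelmerStructure ρ) (d : Finset (HeightOneSpectrum (𝓞 K))) :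
    D'.atLevel 𝓕 d = D.atLevel 𝓕 d := by
  simp only [KolyvaginDatum.atLevel, hT]

/-- The maps `φ^{fs}_𝔮 ∘ loc_𝔮` on global classes depend only on the comparison map at `𝔮`.
[cite: Sakamoto2024, §4 (p. 925), the map `φ^{fs}_q` on `H¹(K,T)`] -/
theorem fsLocalization_eq_of_fs_eq {D D' : KolyvaginDatum ρ} {q : HeightOneSpectrum (𝓞 K)}
    (hfs : D'.fs q = D.fs q) : D'.fsLocalization q = D.fsLocalization q := by
  simp only [KolyvaginDatum.fsLocalization, hfs]

/-! ## Kolyvagin systems restrict to sub-data -/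

/-- **Kolyvagin systems restrict to sub-data (abstract form).**  Let `𝒫(D′) ⊆ 𝒫(D)`, the
transverse conditions of `D′` be those of `D`, and the comparison maps agree at the primes of
`𝒫(D′)`.  If `κ ∈ KS₁(T, 𝓕, 𝒫(D))` and the family `κ′` agrees with `κ` on the levels of `D′` and
vanishes off them, then `κ′ ∈ KS₁(T, 𝓕, 𝒫(D′))`: the three clauses of the definition (support on
`𝒩`, `κ_d ∈ H¹_{𝓕(d)}(K, T)`, and `v_𝔮(κ_{d𝔮}) = φ^{fs}_𝔮(κ_d)` for `𝔮 ∈ 𝒫`, `𝔮 ∉ d`) restrict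
verbatim, every level and every prime of `D′` being one of `D`.
[cite: Sakamoto2024, Def. 4.1 (p. 926)] [cite: Rubin2011, Def. 2.2.1 (p. 18)] -/
theorem isKolyvaginSystem_of_primes_subset {D D' : KolyvaginDatum ρ} {𝓕 : SelmerStructure ρ}
    {κ κ' : Finset (HeightOneSpectrum (𝓞 K)) → galoisCohomology ρ 1}
    (hκ : D.IsKolyvaginSystem 𝓕 κ) (hPP : D'.primes ⊆ D.primes)
    (hT : D'.transverse = D.transverse) (hfs : ∀ q ∈ D'.primes, D'.fs q = D.fs q)
    (hon : ∀ d, D'.IsLevel d → κ' d = κ d) (hoff : ∀ d, ¬ D'.IsLevel d → κ' d = 0) :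
    D'.IsKolyvaginSystem 𝓕 κ' where
  eq_zero_of_not_isLevel := hoff
  mem_selmerGroup d hd := by
    rw [hon d hd, atLevel_eq_of_transverse_eq hT]
    exact hκ.mem_selmerGroup d (isLevel_of_primes_subset hPP hd)
  fs_rel d hd q hq hqd := by
    rw [hon _ (hd.insert hq), hon d hd, fsLocalization_eq_of_fs_eq (hfs q hq)]
    exact hκ.fs_rel d (isLevel_of_primes_subset hPP hd) q (hPP hq) hqd

/-- **Kolyvagin systems restrict to sub-data (extension by zero).**  Under the hypotheses of
`isKolyvaginSystem_of_primes_subset`, the family `d ↦ κ_d` on the levels of `D′`, `0` elsewhere,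
is a Kolyvagin system for `D′`. [cite: Sakamoto2024, Def. 4.1 (p. 926)]
[cite: Rubin2011, Def. 2.2.1 (p. 18)] -/
theorem isKolyvaginSystem_restrict {D D' : KolyvaginDatum ρ} {𝓕 : SelmerStructure ρ}
    {κ : Finset (HeightOneSpectrum (𝓞 K)) → galoisCohomology ρ 1}
    (hκ : D.IsKolyvaginSystem 𝓕 κ) (hPP : D'.primes ⊆ D.primes)
    (hT : D'.transverse = D.transverse) (hfs : ∀ q ∈ D'.primes, D'.fs q = D.fs q) :
    D'.IsKolyvaginSystem 𝓕 fun d => if D'.IsLevel d then κ d else 0 :=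
  isKolyvaginSystem_of_primes_subset hκ hPP hT hfs (fun _ hd => if_pos hd) fun _ hd => if_neg hd

/-- **Kolyvagin systems restrict to thinner prime sets (planner r1's spelling).**  For
`κ ∈ KS₁(T, 𝓕, 𝒫)` and `𝒫′ ⊆ 𝒫`, the family `κ′ d := if ↑d ⊆ 𝒫′ then κ d else 0` is a Kolyvagin
system for the sub-datum `{D with primes := 𝒫′}` (same transverse conditions, same comparison
maps). [cite: Sakamoto2024, Def. 4.1 (p. 926)] [cite: Rubin2011, Def. 2.2.1 (p. 18)] -/
theorem isKolyvaginSystem_restrictPrimes {D : KolyvaginDatum ρ} {𝓕 : SelmerStructure ρ}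
    {κ : Finset (HeightOneSpectrum (𝓞 K)) → galoisCohomology ρ 1}
    (hκ : D.IsKolyvaginSystem 𝓕 κ) {P' : Set (HeightOneSpectrum (𝓞 K))} (hP' : P' ⊆ D.primes) :
    ({ D with primes := P' } : KolyvaginDatum ρ).IsKolyvaginSystem 𝓕
      fun d : Finset (HeightOneSpectrum (𝓞 K)) =>
        if (↑d : Set (HeightOneSpectrum (𝓞 K))) ⊆ P' then κ d else 0 :=
  isKolyvaginSystem_restrict (D' := { D with primes := P' }) hκ hP' rfl fun _ _ => rfl

/-- The `KS₁` form of `isKolyvaginSystem_restrictPrimes`: restriction maps `KS₁(T, 𝓕, 𝒫)` into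
`KS₁(T, 𝓕, 𝒫′)` for `𝒫′ ⊆ 𝒫`. [cite: Sakamoto2024, Def. 4.1 (p. 926)]
[cite: Rubin2011, Def. 2.2.1 (p. 18)] -/
theorem mem_kolyvaginSystems_restrictPrimes {D : KolyvaginDatum ρ} {𝓕 : SelmerStructure ρ}
    {κ : Finset (HeightOneSpectrum (𝓞 K)) → galoisCohomology ρ 1}
    (hκ : κ ∈ D.kolyvaginSystems 𝓕) {P' : Set (HeightOneSpectrum (𝓞 K))} (hP' : P' ⊆ D.primes) :
    (fun d : Finset (HeightOneSpectrum (𝓞 K)) =>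
        if (↑d : Set (HeightOneSpectrum (𝓞 K))) ⊆ P' then κ d else 0) ∈
      ({ D with primes := P' } : KolyvaginDatum ρ).kolyvaginSystems 𝓕 :=
  (mem_kolyvaginSystems_iff _ _ _).2
    (isKolyvaginSystem_restrictPrimes ((mem_kolyvaginSystems_iff _ _ _).1 hκ) hP')

/-- The restricted family has the SAME class as `κ` at every level of the sub-datum.
[cite: Sakamoto2024, Def. 4.1 (p. 926)] -/
theorem restrict_apply_of_isLevel (D' : KolyvaginDatum ρ)
    (κ : Finset (HeightOneSpectrum (𝓞 K)) → galoisCohomology ρ 1)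
    {d : Finset (HeightOneSpectrum (𝓞 K))} (hd : D'.IsLevel d) :
    (fun d => if D'.IsLevel d then κ d else 0) d = κ d :=
  if_pos hd

/-- In particular the restricted family has the same BOTTOM class `κ_1` (`1 ∈ 𝒩` for every
datum) — the class that carries the `L`-value in the applications.
[cite: Sakamoto2024, §2 (p. 921), "the trivial ideal 1 belongs to 𝒩"] -/
theorem restrict_apply_empty (D' : KolyvaginDatum ρ)
    (κ : Finset (HeightOneSpectrum (𝓞 K)) → galoisCohomology ρ 1) :
    (fun d => if D'.IsLevel d then κ d else 0) ∅ = κ ∅ :=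
  if_pos D'.isLevel_empty

omit [NumberField K] in
/-- The prime-set spelling: `(if ↑d ⊆ 𝒫′ then κ d else 0) = κ d` for `↑d ⊆ 𝒫′`, and the bottom
class is unchanged. [cite: Sakamoto2024, Def. 4.1 (p. 926)] -/
theorem restrictPrimes_apply_of_subset (P' : Set (HeightOneSpectrum (𝓞 K)))
    (κ : Finset (HeightOneSpectrum (𝓞 K)) → galoisCohomology ρ 1)
    {d : Finset (HeightOneSpectrum (𝓞 K))} (hd : (↑d : Set (HeightOneSpectrum (𝓞 K))) ⊆ P') :
    (fun d : Finset (HeightOneSpectrum (𝓞 K)) =>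
        if (↑d : Set (HeightOneSpectrum (𝓞 K))) ⊆ P' then κ d else 0) d = κ d :=
  if_pos hd

/-- Restricting a Kolyvagin system to the FULL prime set `𝒫(D)` gives it back (a Kolyvagin system
vanishes off the levels anyway). [cite: Sakamoto2024, Def. 4.1 (p. 926)] -/
theorem restrict_eq_self_of_isKolyvaginSystem {D : KolyvaginDatum ρ} {𝓕 : SelmerStructure ρ}
    {κ : Finset (HeightOneSpectrum (𝓞 K)) → galoisCohomology ρ 1}
    (hκ : D.IsKolyvaginSystem 𝓕 κ) :
    (fun d => if D.IsLevel d then κ d else 0) = κ := by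
  funext d
  by_cases hd : D.IsLevel d
  · exact if_pos hd
  · rw [if_neg hd, hκ.eq_zero_of_not_isLevel d hd]

/-- Restriction is compatible with the group structure of `KS₁`: it is additive in `κ`.
[cite: Sakamoto2024, Def. 4.1 (p. 926), "the R-module KS₁(T, 𝓕)"] -/
theorem restrict_add (D' : KolyvaginDatum ρ)
    (κ₁ κ₂ : Finset (HeightOneSpectrum (𝓞 K)) → galoisCohomology ρ 1) :
    (fun d => if D'.IsLevel d then (κ₁ + κ₂) d else 0) =
      (fun d => if D'.IsLevel d then κ₁ d else 0) + fun d => if D'.IsLevel d then κ₂ d else 0 := by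
  funext d
  by_cases hd : D'.IsLevel d <;> simp [hd]

/-- Restriction is compatible with the `ℤ`-action (hence with the `R = ℤ/p^m`-action) on `KS₁`.
[cite: Sakamoto2024, Def. 4.1 (p. 926), "the R-module KS₁(T, 𝓕)"] -/
theorem restrict_zsmul (D' : KolyvaginDatum ρ) (n : ℤ)
    (κ : Finset (HeightOneSpectrum (𝓞 K)) → galoisCohomology ρ 1) :
    (fun d => if D'.IsLevel d then (n • κ) d else 0) =
      n • fun d => if D'.IsLevel d then κ d else 0 := by
  funext d
  by_cases hd : D'.IsLevel d <;> simp [hd]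

/-- Restricting twice is restricting once: for `𝒫(D″) ⊆ 𝒫(D′)` the two-step extension by zero
equals the one-step one. [cite: Sakamoto2024, Def. 4.1 (p. 926)] -/
theorem restrict_restrict {D' D'' : KolyvaginDatum ρ} (hPP : D''.primes ⊆ D'.primes)
    (κ : Finset (HeightOneSpectrum (𝓞 K)) → galoisCohomology ρ 1) :
    (fun d => if D''.IsLevel d then (fun d => if D'.IsLevel d then κ d else 0) d else 0) =
      fun d => if D''.IsLevel d then κ d else 0 := by
  funext d
  by_cases hd : D''.IsLevel d
  · simp only [if_pos hd, if_pos (isLevel_of_primes_subset hPP hd)]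
  · simp only [if_neg hd]

/-! ## The canonical comparison maps and admissibility are inherited by sub-data -/

/-- **Sub-data keep THE canonical comparison maps for `η`** (Kim's generator-fixed convention):
`HasCanonicalComparison` is a clause "for every `𝔮 ∈ 𝒫`" about `η_𝔮` and `D.fs 𝔮`, so it passes
to any sub-datum with the same comparison maps at its primes.
[cite: Kim2022StructureSelmer, §2.1.2 and §2.2.2] [cite: Sakamoto2024, §4 (p. 925)] -/
theorem hasCanonicalComparison_of_primes_subset {D D' : KolyvaginDatum ρ} {N : ℕ}
    [Module (ZMod N) M] [Module.Free (ZMod N) M] [Module.Finite (ZMod N) M]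
    {η : (q : HeightOneSpectrum (𝓞 K)) → (ZMod (Ideal.absNorm q.asIdeal))ˣ}
    (h : D.HasCanonicalComparison N η) (hPP : D'.primes ⊆ D.primes)
    (hfs : ∀ q ∈ D'.primes, D'.fs q = D.fs q) : D'.HasCanonicalComparison N η := by
  intro q hq
  refine ⟨(h q (hPP hq)).1, fun φ τ hφ hτ hη => ?_⟩
  rw [hfs q hq]
  exact (h q (hPP hq)).2 φ τ hφ hτ hη

/-- The prime-set spelling of `hasCanonicalComparison_of_primes_subset`.
[cite: Kim2022StructureSelmer, §2.2.2] -/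
theorem hasCanonicalComparison_restrictPrimes {D : KolyvaginDatum ρ} {N : ℕ}
    [Module (ZMod N) M] [Module.Free (ZMod N) M] [Module.Finite (ZMod N) M]
    {η : (q : HeightOneSpectrum (𝓞 K)) → (ZMod (Ideal.absNorm q.asIdeal))ˣ}
    (h : D.HasCanonicalComparison N η) {P' : Set (HeightOneSpectrum (𝓞 K))} (hP' : P' ⊆ D.primes) :
    ({ D with primes := P' } : KolyvaginDatum ρ).HasCanonicalComparison N η :=
  hasCanonicalComparison_of_primes_subset (D' := { D with primes := P' }) h hP' fun _ _ => rfl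

/-- **Sub-data of admissible data are admissible** (the comparison maps are bijections
`H¹_ur ⥲ H¹_{/ur}` at every prime of the smaller set). [cite: Sakamoto2024, §4 (p. 925)]
[cite: Rubin2011, Def. 1.9.6 and Exercise 1.9.7 (pp. 14–15)] -/
theorem isAdmissible_of_primes_subset {D D' : KolyvaginDatum ρ} (h : D.IsAdmissible)
    (hPP : D'.primes ⊆ D.primes) (hfs : ∀ q ∈ D'.primes, D'.fs q = D.fs q) : D'.IsAdmissible := by
  intro q hq
  rw [hfs q hq]
  exact h q (hPP hq)

/-- The prime-set spelling of `isAdmissible_of_primes_subset`. [cite: Sakamoto2024, §4 (p. 925)] -/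
theorem isAdmissible_restrictPrimes {D : KolyvaginDatum ρ} (h : D.IsAdmissible)
    {P' : Set (HeightOneSpectrum (𝓞 K))} (hP' : P' ⊆ D.primes) :
    ({ D with primes := P' } : KolyvaginDatum ρ).IsAdmissible :=
  isAdmissible_of_primes_subset (D' := { D with primes := P' }) h hP' fun _ _ => rfl

end Summit.BirchSwinnertonDyer.Rank1Residual.GaloisImage.KSRestrict

end
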